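import Summits.NavierStokesRegularity.NavierStokesRegularity.Theses.SymmetryModuliCount
import Literature.Analysis.FluidPDE.OseenKernelLineIntegrals
import Literature.Analysis.UnboundedOperators.HeatKernelHeatEquation

/-!
# `FiniteTangentModuliMild`: the trivial sectors (zero drift; the streamwise-invariant sector of shear drifts)

Negative-side support for crux stmt-NavierStokesRegularity-14049 (cdisprove seat, cycle 1): two
kernel-checked "small-model" facts about the x-bounded tempered linearised-MILD tangent class of the
crux (`InTangentClass`, the six conjuncts verbatim; `FiniteAt` = the crux's conclusion;
`finiteTangentModuliMild_iff` is definitional).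

* **Zero drift.**  About `u = 0` the class is `{0}` (`tangentClass_zero_drift_eq_zero`): the Oseen
  integrand vanishes by bilinearity, the identity is `v(t) = e^{(t-s)Δ}v(s)`, the heat flow contracts
  the sup norm (`UnboundedOperators.norm_heatExtension_le`) and the envelope `K/√(-s) + K/(-s)` tends
  to `0` as `s → -∞`.  Hence the crux holds at `u = 0` with `N = 0` (`finiteAt_zero_drift`): the count
  `N = 0` is attained.
* **Streamwise-invariant sector of a unidirectional shear drift.**  About ANY drift
  `u(τ, y) = g(τ, y) e₁` with bounded measurable slices invariant under `y ↦ y + δ e₁` (all parallel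
  shear flows `U(t, x₀, x₂) e₁`, in particular the decaying Kolmogorov shear `(1-t)⁻¹ sin(x₀) e₁` of
  the refutation p73226 of the rev-1 crux), every member of the class whose velocity slices are also
  `e₁`-invariant vanishes identically (`shearSector_eq_zero`, `invariantSector_eq_zero_of_inTangentClass`,
  `kolmogorov_invariantSector_eq_zero`).  Mechanism: by the line integrals of the Koch–Tataru kernel
  (`integral_oseenKernel_sub_smul_single_left`, `inner_integral_oseenKernel_sub_smul_single_right`,
  tree file `OseenKernelLineIntegrals`) the Duhamel term of the linearised identity is parallel to
  `e₁`, so the cross-stream components of `v` are mild caloric and vanish as in the zero-drift case;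
  then `v = φ e₁` is itself line-invariant data in the divergence slot, the whole Duhamel term
  vanishes, and `φ = 0` likewise.  CONSEQUENCE for the crux chain: the witness geometry of p73226
  (x-bounded parasitic modes `a^{k+2} cos(x₀) e₁ + B_k(t) e₀`, all `x₁`-independent) is excluded by the
  mild identity alone — the repair is tight against that whole sector, not just against the listed
  modes (companion file `FalseWithoutMild`: without the identity the same modes refute the crux).

## References

* G. Koch, N. Nadirashvili, G. Seregin, V. Šverák, Acta Math. 203 (2009) = arXiv:0709.3599, §1
  (1.7)–(1.9) (mild gauge vs parasitic solutions), proof of Thm 6.2 p. 13 (planar reduction of the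
  Oseen term for data independent of one variable). [KNSS2009]
* H. Koch, D. Tataru, Adv. Math. 157 (2001), §2 (5)–(8), §3 (11), (14). [KochTataruAdvMath2001]
* L. C. Evans, *Partial Differential Equations*, §2.3.1. [Evans2010]
-/

noncomputable section

open Set Function Filter Topology MeasureTheory InnerProductSpace
open scoped Laplacian ContDiff RealInnerProductSpace BigOperators

set_option linter.dupNamespace false

namespace Summit.NavierStokesRegularity.NavierStokesRegularity.Theorems.FiniteTangentModuliMild.Negative

open Literature.Analysis Literature.Analysis.FluidPDE
open Summit.NavierStokesRegularity.NavierStokesRegularity.Theses.SymmetryModuliCount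

/-- Local notation for physical space `ℝ³ = EuclideanSpace ℝ (Fin 3)`. -/
local notation "ℝ³" => EuclideanSpace ℝ (Fin 3)

/-- Local notation for the streamwise unit vector `e₁` (Lean coordinate `1`). -/
local notation "𝐞" => EuclideanSpace.single (1 : Fin 3) (1 : ℝ)

/-! ## The crux, kept under its name (fullbuild repair 2026-08-16)

The crux `FiniteTangentModuliMild` (stmt-NavierStokesRegularity-14049) was DROPPED from the route
`SymmetryModuliCount` at rev 14 (2026-08-16T06:34Z, unused-crux repair; item closed `moot`), so the
gate-written route file `Theses/SymmetryModuliCount.lean` no longer declares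
`Theses.SymmetryModuliCount.FiniteTangentModuliMild`, and `finiteTangentModuliMild_iff` below — whose
statement text may not change (Theorems files are append-only) — stopped elaborating ("Unknown
identifier", full build of 2026-08-16T23:32Z). Its typed statement (the item's ledger signature,
formerly the body of the Theses `def`) is kept here VERBATIM as the `@[conjecture] def
Negative.FiniteTangentModuliMild : Prop` (an open named statement, never asserted; CONVENTIONS §4 /
D-0014), exactly as for the sibling crux `LaminarNeverLoud` in
`Theorems/LaminarNeverLoud/Negative/PowerBudget.lean`. No other declaration changed. -/

/-- **The crux `FiniteTangentModuliMild`** (stmt-NavierStokesRegularity-14049; ledger signature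
verbatim; formerly `Theses.SymmetryModuliCount.FiniteTangentModuliMild`, DROPPED from the route at
rev 14 and closed `moot` — kept here under its name as an `@[conjecture] def`, an unproved statement
being a `Prop`, never a theorem, so that the negative-knowledge lemmas of this directory keep their
subject; use only as a hypothesis or inside `↔`/`¬`): finite tangent moduli in the x-BOUNDED
LINEARISED-MILD gauge for general Type-I drifts — for every smooth divergence-free `u` on
`(-∞,0) × ℝ³` with `|u| ≤ C/√(-t)`, `‖∇u‖ ≤ C/(-t)` there is `N` such that any `N + 1` tempered
classical solutions `(vᵢ, qᵢ)` of the linearised system with the x-bounded velocity envelope, the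
pressure envelope and the linearised Oseen (mild) identity have linearly dependent velocities.
POSED in this project (route route-NavierStokesRegularity-SymmetryModuliCount, repaired rev of the
refuted stmt-4055); its zero-drift and shear-sector instances are proved below. [folklore] -/
@[conjecture] def FiniteTangentModuliMild : Prop :=
  ∀ (C : ℝ) (u : ℝ → EuclideanSpace ℝ (Fin 3) → EuclideanSpace ℝ (Fin 3)), ContDiffOn ℝ (⊤ : ℕ∞) (Function.uncurry u) (Set.Iio 0 ×ˢ Set.univ) → (∀ t < 0, Literature.Analysis.FluidPDE.VectorCalculus.IsDivFree (u t)) → Literature.Analysis.FluidPDE.HasTypeITimeDecay C u → (∀ t < 0, ∀ x, ‖fderiv ℝ (u t) x‖ ≤ C / (-t)) → ∃ N : ℕ, ∀ (v : Fin (N + 1) → ℝ → EuclideanSpace ℝ (Fin 3) → EuclideanSpace ℝ (Fin 3)) (q : Fin (N + 1) → ℝ → EuclideanSpace ℝ (Fin 3) → ℝ), (∀ i, (ContDiffOn ℝ (⊤ : ℕ∞) (Function.uncurry (v i)) (Set.Iio 0 ×ˢ Set.univ) ∧ ContDiffOn ℝ (⊤ : ℕ∞) (Function.uncurry (q i)) (Set.Iio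 0 ×ˢ Set.univ) ∧ (∃ K : ℝ, ∀ t < 0, ∀ x, ‖(v i) t x‖ ≤ K / Real.sqrt (-t) + K / (-t) ∧ |(q i) t x| ≤ K / (-t) + K * (1 + ‖x‖) / Real.sqrt (-t) ^ 3) ∧ (∀ t < 0, Literature.Analysis.FluidPDE.VectorCalculus.IsDivFree ((v i) t)) ∧ (∀ t < 0, ∀ x, Literature.Analysis.FluidPDE.timeDeriv (v i) t x + Literature.Analysis.FluidPDE.convect (u t) ((v i) t) x + Literature.Analysis.FluidPDE.convect ((v i) t) (u t) x = Laplacian.laplacian ((v i) t) x - gradient ((q i) t) x) ∧ (∀ s t : ℝ, s < t → t < 0 → ∀ x, (v i) t x = Literature.Analysis.FluidPDE.heatFlow ((v i) s) (t - s) x - ∫ τ in Set.Ioo s t, ∫ y, (Literature.Analysis.FluidPDE.oseenKernel (t - τ) (x - y) (u τ y) ((v i) τ y) + Literature.Analysis.FluidPDE.oseenKernel (t - τ) (x - y) ((v i) τ y) (u τ y))))) → ∃ c : Fin (N + 1) → ℝ, c ≠ 0 ∧ ∀ t < 0, ∀ x, ∑ i, c i • v i t x = 0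

/-! ## The class and the conclusion of the crux, factored (definitional) -/

/-- The x-bounded tempered linearised-mild tangent class about the drift `u`: the six conjuncts of the
crux, verbatim (smooth `v`, smooth `q`, envelopes, `div v = 0`, linearised momentum equation,
linearised Oseen identity). -/
def InTangentClass (u v : ℝ → ℝ³ → ℝ³) (q : ℝ → ℝ³ → ℝ) : Prop :=
  ContDiffOn ℝ (⊤ : ℕ∞) (Function.uncurry v) (Set.Iio 0 ×ˢ Set.univ) ∧
  ContDiffOn ℝ (⊤ : ℕ∞) (Function.uncurry q) (Set.Iio 0 ×ˢ Set.univ) ∧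
  (∃ K : ℝ, ∀ t < 0, ∀ x, ‖v t x‖ ≤ K / Real.sqrt (-t) + K / (-t) ∧
    |q t x| ≤ K / (-t) + K * (1 + ‖x‖) / Real.sqrt (-t) ^ 3) ∧
  (∀ t < 0, VectorCalculus.IsDivFree (v t)) ∧
  (∀ t < 0, ∀ x, timeDeriv v t x + convect (u t) (v t) x + convect (v t) (u t) x =
    Δ (v t) x - gradient (q t) x) ∧
  (∀ s t : ℝ, s < t → t < 0 → ∀ x, v t x = heatFlow (v s) (t - s) x -
    ∫ τ in Set.Ioo s t, ∫ y, (oseenKernel (t - τ) (x - y) (u τ y) (v τ y) +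
      oseenKernel (t - τ) (x - y) (v τ y) (u τ y)))

/-- "The tangent class about `u` is finite-dimensional": the conclusion of the crux for the drift `u`. -/
def FiniteAt (u : ℝ → ℝ³ → ℝ³) : Prop :=
  ∃ N : ℕ, ∀ (v : Fin (N + 1) → ℝ → ℝ³ → ℝ³) (q : Fin (N + 1) → ℝ → ℝ³ → ℝ),
    (∀ i, InTangentClass u (v i) (q i)) → ∃ c : Fin (N + 1) → ℝ, c ≠ 0 ∧ ∀ t < 0, ∀ x, ∑ i, c i • v i t x = 0

/-- The crux, refactored through `InTangentClass` / `FiniteAt` (definitional). -/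
theorem finiteTangentModuliMild_iff :
    FiniteTangentModuliMild ↔ ∀ (C : ℝ) (u : ℝ → ℝ³ → ℝ³),
      ContDiffOn ℝ (⊤ : ℕ∞) (Function.uncurry u) (Set.Iio 0 ×ˢ Set.univ) →
      (∀ t < 0, VectorCalculus.IsDivFree (u t)) → HasTypeITimeDecay C u →
      (∀ t < 0, ∀ x, ‖fderiv ℝ (u t) x‖ ≤ C / (-t)) → FiniteAt u :=
  Iff.rfl

/-- Slices of a field smooth on `(-∞,0) × ℝ³` are (strongly) measurable. -/
theorem aestronglyMeasurable_slice {F' : Type*} [NormedAddCommGroup F'] [NormedSpace ℝ F']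
    {v : ℝ → ℝ³ → F'} (hv : ContDiffOn ℝ (⊤ : ℕ∞) (Function.uncurry v) (Set.Iio 0 ×ˢ Set.univ))
    {τ : ℝ} (hτ : τ < 0) : AEStronglyMeasurable (v τ) volume := by
  have hc : Continuous fun y : ℝ³ => ((τ, y) : ℝ × ℝ³) := by fun_prop
  have h2 : Continuous ((Function.uncurry v) ∘ fun y : ℝ³ => ((τ, y) : ℝ × ℝ³)) :=
    hv.continuousOn.comp_continuous hc fun y => ⟨hτ, mem_univ _⟩
  exact h2.aestronglyMeasurable

/-! ## Zero drift -/

/-- The backward-decaying envelope `K/√(-s) + K/(-s)` tends to `0` as `s → -∞`. -/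
theorem tendsto_envelope_atBot (K : ℝ) :
    Tendsto (fun s : ℝ => K / Real.sqrt (-s) + K / (-s)) atBot (𝓝 0) := by
  have h1 : Tendsto (fun s : ℝ => -s) atBot atTop := tendsto_neg_atBot_atTop
  have h2 : Tendsto (fun s : ℝ => Real.sqrt (-s)) atBot atTop := Real.tendsto_sqrt_atTop.comp h1
  have h3 : Tendsto (fun s : ℝ => K / Real.sqrt (-s)) atBot (𝓝 0) := tendsto_const_nhds.div_atTop h2
  have h4 : Tendsto (fun s : ℝ => K / (-s)) atBot (𝓝 0) := tendsto_const_nhds.div_atTop h1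
  simpa using h3.add h4

/-- **Zero drift: the class is trivial.**  If `v` obeys the x-bounded backward-decaying envelope and
the linearised Oseen identity about `u = 0`, then `v ≡ 0` on `t < 0`.  Smoothness, divergence, the
PDE and the pressure are not used. -/
theorem tangentClass_zero_drift_eq_zero (v : ℝ → ℝ³ → ℝ³) {K : ℝ}
    (hK : ∀ t < 0, ∀ x, ‖v t x‖ ≤ K / Real.sqrt (-t) + K / (-t))
    (hmild : ∀ s t : ℝ, s < t → t < 0 → ∀ x, v t x = heatFlow (v s) (t - s) x -
      ∫ τ in Set.Ioo s t, ∫ y, (oseenKernel (t - τ) (x - y) ((0 : ℝ → ℝ³ → ℝ³) τ y) (v τ y) +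
        oseenKernel (t - τ) (x - y) (v τ y) ((0 : ℝ → ℝ³ → ℝ³) τ y))) :
    ∀ t < 0, ∀ x, v t x = 0 := by
  intro t ht x
  have hbound : ∀ s < t, ‖v t x‖ ≤ K / Real.sqrt (-s) + K / (-s) := by
    intro s hs
    have hid := hmild s t hs ht x
    simp only [Pi.zero_apply, oseenKernel_zero_left, oseenKernel_zero_right, add_zero,
      integral_zero, sub_zero] at hid
    rw [hid, heatFlow_of_pos _ (sub_pos.2 hs)]
    exact UnboundedOperators.norm_heatExtension_le (fun z => hK s (hs.trans ht) z) (sub_pos.2 hs) x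
  have hle : ‖v t x‖ ≤ 0 :=
    ge_of_tendsto (tendsto_envelope_atBot K) ((eventually_lt_atBot t).mono fun s hs => hbound s hs)
  exact norm_le_zero_iff.1 hle

/-- **The crux holds about the zero drift with `N = 0`** (the count `N = 0` is attained). -/
theorem finiteAt_zero_drift : FiniteAt (0 : ℝ → ℝ³ → ℝ³) := by
  refine ⟨0, fun v q h => ⟨fun _ => 1, ?_, fun t ht x => ?_⟩⟩
  · intro h0
    simpa using congrFun h0 0
  · obtain ⟨K, hK⟩ := (h 0).2.2.1
    have hz := tangentClass_zero_drift_eq_zero (v 0) (fun t ht x => (hK t ht x).1) (h 0).2.2.2.2.2 t ht x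
    simp [hz]

/-! ## The streamwise-invariant sector of a unidirectional shear drift -/

/-- `‖e₁‖ = 1`. -/
theorem norm_streamwise : ‖(𝐞 : ℝ³)‖ = 1 := by
  simp

/-- Slice lemma: for line-invariant bounded data `g e₁` (drift) and `b` (perturbation) the inner
`y`-integral of the linearised Oseen identity has no component orthogonal to `e₁`. -/
theorem inner_integral_oseen_shear_eq_zero {σ : ℝ} (hσ : 0 < σ) {g : ℝ³ → ℝ} {b : ℝ³ → ℝ³}
    (hgm : AEStronglyMeasurable g volume) (hbm : AEStronglyMeasurable b volume)
    {Mg Mb : ℝ} (hgb : ∀ y, |g y| ≤ Mg) (hbb : ∀ y, ‖b y‖ ≤ Mb)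
    (hgi : ∀ (y : ℝ³) (δ : ℝ), g (y + EuclideanSpace.single 1 δ) = g y)
    (hbi : ∀ (y : ℝ³) (δ : ℝ), b (y + EuclideanSpace.single 1 δ) = b y)
    (x : ℝ³) {w : ℝ³} (hw : ⟪w, 𝐞⟫ = 0) :
    ⟪∫ y, (oseenKernel σ (x - y) (g y • 𝐞) (b y) + oseenKernel σ (x - y) (b y) (g y • 𝐞)), w⟫ = 0 := by
  have hgb' : ∀ y, ‖g y • 𝐞‖ ≤ |Mg| := fun y => by
    rw [norm_smul, norm_streamwise, mul_one, Real.norm_eq_abs]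
    exact (hgb y).trans (le_abs_self _)
  have hgm' : AEStronglyMeasurable (fun y => g y • 𝐞) volume := hgm.smul_const _
  have h1 : Integrable fun y => oseenKernel σ (x - y) (g y • 𝐞) (b y) :=
    integrable_oseenKernel_sub_of_bounded hσ hgm' hbm hgb' hbb x
  have h2 : Integrable fun y => oseenKernel σ (x - y) (b y) (g y • 𝐞) :=
    integrable_oseenKernel_sub_of_bounded hσ hbm hgm' hbb hgb' x
  rw [integral_add h1 h2, inner_add_left,
    integral_oseenKernel_sub_smul_single_left hσ hgm hbm hgb hbb hgi hbi x, inner_zero_left, zero_add]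
  exact inner_integral_oseenKernel_sub_smul_single_right hσ hbm hgm hbb hgb hbi hgi x hw

/-- If a curve `G` is pointwise orthogonal to `w` on `S`, so is `∫_S G` (whether or not `G` is
integrable: the junk value `0` is orthogonal to everything). -/
theorem inner_setIntegral_eq_zero {G : ℝ → ℝ³} {S : Set ℝ} {w : ℝ³}
    (h : ∀ τ ∈ S, ⟪G τ, w⟫ = 0) : ⟪∫ τ in S, G τ, w⟫ = 0 := by
  by_cases hG : IntegrableOn G S volume
  · rw [real_inner_comm, ← integral_inner hG w]
    refine setIntegral_eq_zero_of_forall_eq_zero fun τ hτ => ?_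
    rw [real_inner_comm]
    exact h τ hτ
  · rw [integral_undef hG, inner_zero_left]

/-- `|z 1| ≤ ‖z‖` on `ℝ³`. -/
theorem abs_apply_one_le_norm (z : ℝ³) : |z 1| ≤ ‖z‖ := by
  have := PiLp.norm_apply_le z 1
  simpa [Real.norm_eq_abs] using this

/-- **The streamwise-invariant sector of a unidirectional shear drift is trivial.**  Let the drift be
`u(τ, y) = g(τ, y) e₁` with bounded measurable slices invariant under `y ↦ y + δe₁` (`τ < 0`), and
let `v` have measurable `e₁`-invariant slices, obey the x-bounded backward-decaying envelope and the
linearised Oseen identity about `u`.  Then `v ≡ 0` on `t < 0`.  (First the components orthogonal to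
`e₁` — the Duhamel term is parallel to `e₁` by the line integrals of the kernel, so they are bounded
by `‖e^{(t-s)Δ}v(s)‖ → 0`; then `v = φ e₁` is line-invariant data in the divergence slot, the Duhamel
term vanishes, and `φ` goes the same way.) -/
theorem shearSector_eq_zero (g : ℝ → ℝ³ → ℝ) (v : ℝ → ℝ³ → ℝ³)
    (hgm : ∀ τ < 0, AEStronglyMeasurable (g τ) volume) (hgb : ∀ τ < 0, ∃ M : ℝ, ∀ y, |g τ y| ≤ M)
    (hgi : ∀ τ < 0, ∀ (y : ℝ³) (δ : ℝ), g τ (y + EuclideanSpace.single 1 δ) = g τ y)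
    (hvm : ∀ τ < 0, AEStronglyMeasurable (v τ) volume)
    {K : ℝ} (hK : ∀ t < 0, ∀ x, ‖v t x‖ ≤ K / Real.sqrt (-t) + K / (-t))
    (hvi : ∀ τ < 0, ∀ (y : ℝ³) (δ : ℝ), v τ (y + EuclideanSpace.single 1 δ) = v τ y)
    (hmild : ∀ s t : ℝ, s < t → t < 0 → ∀ x, v t x = heatFlow (v s) (t - s) x -
      ∫ τ in Set.Ioo s t, ∫ y, (oseenKernel (t - τ) (x - y) (g τ y • 𝐞) (v τ y) +
        oseenKernel (t - τ) (x - y) (v τ y) (g τ y • 𝐞))) :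
    ∀ t < 0, ∀ x, v t x = 0 := by
  -- Step 1: the components orthogonal to `e₁` vanish.
  have hperp : ∀ {w : ℝ³}, ⟪w, 𝐞⟫ = 0 → ∀ t < 0, ∀ x, ⟪v t x, w⟫ = 0 := by
    intro w hw t ht x
    have hb : ∀ s < t, |⟪v t x, w⟫| ≤ (K / Real.sqrt (-s) + K / (-s)) * ‖w‖ := by
      intro s hs
      have hid := hmild s t hs ht x
      have hD : ⟪∫ τ in Ioo s t, ∫ y, (oseenKernel (t - τ) (x - y) (g τ y • 𝐞) (v τ y) +
          oseenKernel (t - τ) (x - y) (v τ y) (g τ y • 𝐞)), w⟫ = 0 := by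
        refine inner_setIntegral_eq_zero fun τ hτ => ?_
        have hτ0 : τ < 0 := hτ.2.trans ht
        obtain ⟨Mg, hMg⟩ := hgb τ hτ0
        exact inner_integral_oseen_shear_eq_zero (sub_pos.2 hτ.2) (hgm τ hτ0) (hvm τ hτ0) hMg
          (fun y => hK τ hτ0 y) (hgi τ hτ0) (hvi τ hτ0) x hw
      have heq : ⟪v t x, w⟫ = ⟪heatFlow (v s) (t - s) x, w⟫ := by
        rw [hid, inner_sub_left, hD, sub_zero]
      rw [heq]
      refine (abs_real_inner_le_norm _ _).trans (mul_le_mul_of_nonneg_right ?_ (norm_nonneg _))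
      rw [heatFlow_of_pos _ (sub_pos.2 hs)]
      exact UnboundedOperators.norm_heatExtension_le (fun z => hK s (hs.trans ht) z) (sub_pos.2 hs) x
    have hlim : Tendsto (fun s : ℝ => (K / Real.sqrt (-s) + K / (-s)) * ‖w‖) atBot (𝓝 0) := by
      simpa using (tendsto_envelope_atBot K).mul_const ‖w‖
    have hle : |⟪v t x, w⟫| ≤ 0 :=
      ge_of_tendsto hlim ((eventually_lt_atBot t).mono fun s hs => hb s hs)
    exact abs_nonpos_iff.1 hle
  -- Step 2: hence `v = (v·e₁) e₁` on `t < 0`.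
  have hpar : ∀ τ < 0, ∀ y, v τ y = (v τ y 1) • 𝐞 := by
    intro τ hτ y
    have h0 : v τ y 0 = 0 := by
      have := hperp (w := EuclideanSpace.single 0 1)
        (by simp [EuclideanSpace.inner_single_left]) τ hτ y
      simpa [EuclideanSpace.inner_single_right] using this
    have h2 : v τ y 2 = 0 := by
      have := hperp (w := EuclideanSpace.single 2 1)
        (by simp [EuclideanSpace.inner_single_left]) τ hτ y
      simpa [EuclideanSpace.inner_single_right] using this
    ext j
    fin_cases j <;> simp [h0, h2]
  -- Step 3: the whole Duhamel term vanishes, and `v` is mild caloric with decaying envelope.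
  intro t ht x
  have hb : ∀ s < t, ‖v t x‖ ≤ K / Real.sqrt (-s) + K / (-s) := by
    intro s hs
    have hid := hmild s t hs ht x
    have hzero : ∫ τ in Ioo s t, ∫ y, (oseenKernel (t - τ) (x - y) (g τ y • 𝐞) (v τ y) +
        oseenKernel (t - τ) (x - y) (v τ y) (g τ y • 𝐞)) = 0 := by
      refine setIntegral_eq_zero_of_forall_eq_zero fun τ hτ => ?_
      have hτ0 : τ < 0 := hτ.2.trans ht
      have hσ : 0 < t - τ := sub_pos.2 hτ.2
      obtain ⟨Mg, hMg⟩ := hgb τ hτ0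
      have hgm' : AEStronglyMeasurable (fun y => g τ y • 𝐞) volume := (hgm τ hτ0).smul_const _
      have hgb' : ∀ y, ‖g τ y • 𝐞‖ ≤ |Mg| := fun y => by
        rw [norm_smul, norm_streamwise, mul_one, Real.norm_eq_abs]
        exact (hMg y).trans (le_abs_self _)
      have hφm : AEStronglyMeasurable (fun y => v τ y 1) volume :=
        (EuclideanSpace.proj (1 : Fin 3) : ℝ³ →L[ℝ] ℝ).continuous.comp_aestronglyMeasurable (hvm τ hτ0)
      have hφb : ∀ y, |v τ y 1| ≤ K / Real.sqrt (-τ) + K / (-τ) := fun y =>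
        (abs_apply_one_le_norm _).trans (hK τ hτ0 y)
      have hφi : ∀ (y : ℝ³) (δ : ℝ), v τ (y + EuclideanSpace.single 1 δ) 1 = v τ y 1 := fun y δ => by
        rw [hvi τ hτ0]
      have hgi' : ∀ (y : ℝ³) (δ : ℝ), g τ (y + EuclideanSpace.single 1 δ) • 𝐞 = g τ y • 𝐞 :=
        fun y δ => by rw [hgi τ hτ0]
      have h1 : Integrable fun y => oseenKernel (t - τ) (x - y) (g τ y • 𝐞) (v τ y) :=
        integrable_oseenKernel_sub_of_bounded hσ hgm' (hvm τ hτ0) hgb' (fun y => hK τ hτ0 y) x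
      have h2 : Integrable fun y => oseenKernel (t - τ) (x - y) (v τ y) (g τ y • 𝐞) :=
        integrable_oseenKernel_sub_of_bounded hσ (hvm τ hτ0) hgm' (fun y => hK τ hτ0 y) hgb' x
      rw [integral_add h1 h2, integral_oseenKernel_sub_smul_single_left hσ (hgm τ hτ0) (hvm τ hτ0)
        hMg (fun y => hK τ hτ0 y) (hgi τ hτ0) (hvi τ hτ0) x, zero_add]
      have hv_eq : (fun y => oseenKernel (t - τ) (x - y) (v τ y) (g τ y • 𝐞)) =
          fun y => oseenKernel (t - τ) (x - y) ((v τ y 1) • 𝐞) (g τ y • 𝐞) := by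
        funext y
        exact congrArg (fun a => oseenKernel (t - τ) (x - y) a (g τ y • 𝐞)) (hpar τ hτ0 y)
      rw [hv_eq]
      exact integral_oseenKernel_sub_smul_single_left hσ hφm hgm' hφb hgb' hφi hgi' x
    rw [hid, hzero, sub_zero, heatFlow_of_pos _ (sub_pos.2 hs)]
    exact UnboundedOperators.norm_heatExtension_le (fun z => hK s (hs.trans ht) z) (sub_pos.2 hs) x
  have hle : ‖v t x‖ ≤ 0 :=
    ge_of_tendsto (tendsto_envelope_atBot K) ((eventually_lt_atBot t).mono fun s hs => hb s hs)
  exact norm_le_zero_iff.1 hle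

/-- **Class version.**  About a unidirectional shear drift `u = g e₁` (bounded measurable `e₁`-invariant
slices) every member `(v, q)` of the crux's tangent class with `e₁`-invariant velocity slices is `0`. -/
theorem invariantSector_eq_zero_of_inTangentClass (g : ℝ → ℝ³ → ℝ)
    (hgm : ∀ τ < 0, AEStronglyMeasurable (g τ) volume) (hgb : ∀ τ < 0, ∃ M : ℝ, ∀ y, |g τ y| ≤ M)
    (hgi : ∀ τ < 0, ∀ (y : ℝ³) (δ : ℝ), g τ (y + EuclideanSpace.single 1 δ) = g τ y)
    {v : ℝ → ℝ³ → ℝ³} {q : ℝ → ℝ³ → ℝ} (hv : InTangentClass (fun τ y => g τ y • 𝐞) v q)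
    (hvi : ∀ τ < 0, ∀ (y : ℝ³) (δ : ℝ), v τ (y + EuclideanSpace.single 1 δ) = v τ y) :
    ∀ t < 0, ∀ x, v t x = 0 := by
  obtain ⟨K, hK⟩ := hv.2.2.1
  exact shearSector_eq_zero g v hgm hgb hgi (fun τ hτ => aestronglyMeasurable_slice hv.1 hτ)
    (fun t ht x => (hK t ht x).1) hvi hv.2.2.2.2.2

/-- The decaying Kolmogorov shear `u(t, x) = (1-t)⁻¹ sin(x₀) e₁` of the refutation p73226 (there
`FiniteTangentModuliCex.drift = shear (fun s => (1-t)⁻¹ sin s)`; same field). -/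
def kolmogorovDrift (t : ℝ) (y : ℝ³) : ℝ³ := ((1 - t)⁻¹ * Real.sin (y 0)) • 𝐞

/-- **The p73226 geometry is dead against the mild crux**: about the decaying Kolmogorov shear every
member of the tangent class with `x₁`-independent velocity (the sector containing all the parasitic
modes `a^{k+2} cos(x₀) e₁ + B_k(t) e₀` of p73226) vanishes identically. -/
theorem kolmogorov_invariantSector_eq_zero {v : ℝ → ℝ³ → ℝ³} {q : ℝ → ℝ³ → ℝ}
    (hv : InTangentClass kolmogorovDrift v q)
    (hvi : ∀ τ < 0, ∀ (y : ℝ³) (δ : ℝ), v τ (y + EuclideanSpace.single 1 δ) = v τ y) :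
    ∀ t < 0, ∀ x, v t x = 0 := by
  have hcont : ∀ τ : ℝ, Continuous fun y : ℝ³ => (1 - τ)⁻¹ * Real.sin (y 0) := fun τ =>
    continuous_const.mul (Real.continuous_sin.comp (EuclideanSpace.proj (0 : Fin 3) : ℝ³ →L[ℝ] ℝ).continuous)
  refine invariantSector_eq_zero_of_inTangentClass (fun τ y => (1 - τ)⁻¹ * Real.sin (y 0))
    (fun τ _ => (hcont τ).aestronglyMeasurable) (fun τ _ => ⟨|(1 - τ)⁻¹|, fun y => ?_⟩)
    (fun τ _ y δ => by simp) hv hvi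
  rw [abs_mul]
  exact mul_le_of_le_one_right (abs_nonneg _) (Real.abs_sin_le_one _)

end Summit.NavierStokesRegularity.NavierStokesRegularity.Theorems.FiniteTangentModuliMild.Negative

end
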